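import Mathlib
import Literature.Computability.AlgebraicComplexity.PermanentIrreducible
import Literature.Computability.AlgebraicComplexity.StandardFamiliesProofs
import Summits.ValiantsHypothesis.ValiantsHypothesis.Theorems.DivisionGapPerCofactorDegreeReductionStubAdditiveCreation
import Summits.ValiantsHypothesis.ValiantsHypothesis.Theorems.PerCofactorDegreeReduction.Negative.TwoTowerStrict

/-!
# Crux `DivisionGap.PerCofactorDegreeReduction` (stmt-ValiantsHypothesis-15046), line `Sketch` —
# stub `stub_disjointClassSterile`: a cell-disjoint class of permutation monomials is sterile

**Theorem (`stub_disjointClassSterile`).** Let `n ≥ 3` and let `σ_i` (`i ∈ ι`, `ι` finite) be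
permutations of `Fin n` with pairwise disjoint graphs (`σ_i(c) = σ_j(c) ⇒ i = j`).  If the value
`F = R(x^{μ_σ})` of a real polynomial `R ∈ ℝ[y_i : i ∈ ι]` at the permutation monomials
`y_i ↦ x^{μ_{σ_i}} = ∏_c x_{σ_i(c), c}` is a multiple of `per_n`, then `F = 0`.

## Proof (torus scaling)

* *The torus action.*  For weights `w : cells → ℝ` the algebra endomorphism
  `scale_w := aeval (v ↦ w_v x_v) : x_v ↦ w_v x_v` of `ℝ[x]` multiplies `a x^m` by
  `∏_v w_v^{m_v}` (`scale_monomial`, `coeff_scale`); for pointwise invertible weights it is an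
  automorphism (inverse `scale_{w⁻¹}`), so it preserves irreducibility (`irreducible_scale`).
* *The weights.*  Pick `ρ` with `σ_i(c₁) = ρ(c₁) ⇔ σ_i(c₂) = ρ(c₂)` for all `i` (`ρ = σ_{i₀}` if
  `ι` is inhabited, by disjointness; `ρ = 1` if `ι = ∅`), three distinct columns
  `c₁, c₂, c₃ = 0, 1, 2` (`n ≥ 3`) and, for `t ≠ 0`, the weights `t` at the cell `e₁ = (ρ c₁, c₁)`,
  `t⁻¹` at `e₂ = (ρ c₂, c₂)` and `1` elsewhere.  The weight of `x^{μ_π}` is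
  `t^{[π c₁ = ρ c₁]} · (t⁻¹)^{[π c₂ = ρ c₂]}` (`prod_wt_pow_permMonomial`); for `π = σ_i` the two
  exponents agree, so every generator `x^{μ_{σ_i}}`, hence `F`, is FIXED (`comp_aeval`).
* *Infinitely many prime divisors.*  `per_t := scale_t(per_n)` is irreducible
  (`perPoly_irreducible` transported) and divides `scale_t(F) = F`.  If `per_t ~ per_{t'}` then
  `per_t · C c = per_{t'}` (units of `ℝ[x]` are constants, `isUnit_iff_eq_C_of_isReduced`); the
  coefficient at `μ_ρ` (weight `t t⁻¹ = 1`) gives `c = 1`, and the coefficient at `μ_τ`,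
  `τ = ρ ∘ (c₂ c₃)` (through `e₁`, not through `e₂`; weight `t`) gives `t = t'`
  (`eq_of_associated_scale_perPoly`).  So `per_1, per_2, per_3, …` are pairwise non-associated
  irreducible divisors of `F`; if `F ≠ 0` each is associated to a member of the finite multiset
  `factors F` (`UniqueFactorizationMonoid.exists_mem_factors_of_dvd`), and pigeonhole gives
  `k ≠ k'` with `per_{k+1} ~ per_{k'+1}` — contradiction (`eq_zero_of_fixed_of_perPoly_dvd`).
-/

noncomputable section

-- `Summit.ValiantsHypothesis.ValiantsHypothesis.…` is the tree's mandated single-conjunct layout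
-- (Problem = Summit), so the duplicated namespace component is intended.
set_option linter.dupNamespace false

namespace Summit.ValiantsHypothesis.ValiantsHypothesis.Theorems.DivisionGap.PerCofactorDegreeReduction.DisjointClassSterile

open MvPolynomial Literature.Computability.AlgebraicComplexity
open scoped NNReal BigOperators

/-! ### The diagonal torus action `scale_w = aeval (v ↦ w_v x_v)` on a polynomial ring -/

section Scale

variable {α : Type*} {K : Type*} [CommSemiring K]

/-- The diagonal torus action `scale_w := aeval (v ↦ w_v x_v)` (the algebra endomorphism
`x_v ↦ w_v x_v` of `K[x_v : v ∈ α]`) on variables: `scale_w (x_v) = w_v · x_v`. [folklore] -/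
theorem scale_X (w : α → K) (v : α) :
    MvPolynomial.aeval (fun v => C (w v) * X v) (X v : MvPolynomial α K) = C (w v) * X v :=
  aeval_X _ v

/-- The torus action multiplies the term `a x^m` by the weight `∏_v w_v^{m_v}` of `m`. [folklore] -/
theorem scale_monomial (w : α → K) (m : α →₀ ℕ) (a : K) :
    MvPolynomial.aeval (fun v => C (w v) * X v) (monomial m a) =
      monomial m ((m.prod fun v k => w v ^ k) * a) := by
  have h1 : (m.prod fun v k => (C (w v) * X v : MvPolynomial α K) ^ k) =
      C (m.prod fun v k => w v ^ k) * m.prod fun v k => (X v : MvPolynomial α K) ^ k := by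
    rw [map_finsuppProd, ← Finsupp.prod_mul]
    refine Finsupp.prod_congr fun v _ => ?_
    rw [mul_pow, C_pow]
  rw [aeval_monomial, algebraMap_eq, h1, monomial_eq (s := m), map_mul]
  ring

/-- Coefficients under the torus action: `[x^m] scale_w(p) = (∏_v w_v^{m_v}) · [x^m] p`.
[folklore] -/
theorem coeff_scale (w : α → K) (m : α →₀ ℕ) (p : MvPolynomial α K) :
    coeff m (MvPolynomial.aeval (fun v => C (w v) * X v) p) =
      (m.prod fun v k => w v ^ k) * coeff m p := by
  classical
  induction p using MvPolynomial.induction_on' with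
  | monomial d a =>
    rw [scale_monomial, coeff_monomial, coeff_monomial]
    split_ifs with h
    · rw [h]
    · rw [mul_zero]
  | add p q hp hq => rw [map_add, coeff_add, coeff_add, hp, hq, mul_add]

/-- Torus actions with pointwise inverse weights compose to the identity. [folklore] -/
theorem scale_comp_scale {w w' : α → K} (h : ∀ v, w v * w' v = 1) :
    (MvPolynomial.aeval fun v => C (w v) * X v).comp (MvPolynomial.aeval fun v => C (w' v) * X v) =
      AlgHom.id K (MvPolynomial α K) := by
  refine MvPolynomial.algHom_ext fun v => ?_
  rw [AlgHom.comp_apply, AlgHom.id_apply, scale_X, map_mul, algHom_C, algebraMap_eq, scale_X,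
    ← mul_assoc, ← map_mul, mul_comm (w' v), h, map_one, one_mul]

/-- For pointwise invertible weights the torus action is an algebra automorphism
(`AlgEquiv.ofAlgHom` with inverse `scale_{w'}`), hence it preserves irreducibility. [folklore] -/
theorem irreducible_scale {w w' : α → K} (h : ∀ v, w v * w' v = 1) {p : MvPolynomial α K}
    (hp : Irreducible p) : Irreducible (MvPolynomial.aeval (fun v => C (w v) * X v) p) :=
  (MulEquiv.irreducible_iff (AlgEquiv.ofAlgHom (R := K)
    (MvPolynomial.aeval fun v => C (w v) * X v) (MvPolynomial.aeval fun v => C (w' v) * X v)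
    (scale_comp_scale h) (scale_comp_scale fun v => by rw [mul_comm]; exact h v))).mpr hp

end Scale

/-! ### The weights `e₁ ↦ t`, `e₂ ↦ t⁻¹` of the one-parameter torus
`x_{e₁} ↦ t x_{e₁}`, `x_{e₂} ↦ t⁻¹ x_{e₂}` -/

section Weights

variable {α : Type*} [DecidableEq α]

/-- The weights for `t` and for `t⁻¹` are pointwise inverse (`t ≠ 0`). [folklore] -/
theorem wt_mul_wt_inv (e₁ e₂ : α) {t : ℝ} (ht : t ≠ 0) (v : α) :
    (Pi.mulSingle e₁ t * Pi.mulSingle e₂ t⁻¹ : α → ℝ) v *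
      (Pi.mulSingle e₁ t⁻¹ * Pi.mulSingle e₂ t⁻¹⁻¹ : α → ℝ) v = 1 := by
  simp only [Pi.mul_apply, Pi.mulSingle_apply]
  split_ifs <;> field_simp

/-- The weight of the monomial `x^m` is `t^{m(e₁)} (t⁻¹)^{m(e₂)}`. [folklore] -/
theorem prod_wt_pow [Fintype α] (e₁ e₂ : α) (t : ℝ) (m : α →₀ ℕ) :
    (m.prod fun v k => (Pi.mulSingle e₁ t * Pi.mulSingle e₂ t⁻¹ : α → ℝ) v ^ k) =
      t ^ m e₁ * t⁻¹ ^ m e₂ := by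
  rw [Finsupp.prod_fintype _ _ fun v => pow_zero _]
  simp only [Pi.mul_apply, Pi.mulSingle_apply, mul_pow, Finset.prod_mul_distrib, ite_pow, one_pow,
    Fintype.prod_ite_eq']

/-- In particular the weight of the permutation monomial `x^{μ_π}` for the cells
`e₁ = (ρ c₁, c₁)`, `e₂ = (ρ c₂, c₂)` is `t^{[π c₁ = ρ c₁]} (t⁻¹)^{[π c₂ = ρ c₂]}`. [folklore] -/
theorem prod_wt_pow_permMonomial {m : Type*} [Fintype m] [DecidableEq m] (ρ π : Equiv.Perm m)
    (c₁ c₂ : m) (t : ℝ) {w : m × m → ℝ}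
    (hw : w = Pi.mulSingle (ρ c₁, c₁) t * Pi.mulSingle (ρ c₂, c₂) t⁻¹) :
    ((permMonomial π).prod fun v k => w v ^ k) =
      t ^ (if π c₁ = ρ c₁ then 1 else 0) * t⁻¹ ^ (if π c₂ = ρ c₂ then 1 else 0) := by
  rw [hw, prod_wt_pow, permMonomial_apply, permMonomial_apply]

end Weights

/-! ### The scaled permanents `per_t` -/

section Main

variable {n : ℕ}

/-- The scaled permanent `per_t = scale_{w_t}(per_n)` (`w_t` the weights `t` at `(ρ c₁, c₁)`, `t⁻¹`
at `(ρ c₂, c₂)`) has coefficient `t^{[π c₁ = ρ c₁]} (t⁻¹)^{[π c₂ = ρ c₂]}` at `x^{μ_π}`.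
[folklore] -/
theorem coeff_permMonomial_scale_perPoly (ρ π : Equiv.Perm (Fin n)) (c₁ c₂ : Fin n) (t : ℝ)
    {w : Fin n × Fin n → ℝ} (hw : w = Pi.mulSingle (ρ c₁, c₁) t * Pi.mulSingle (ρ c₂, c₂) t⁻¹) :
    coeff (permMonomial π) (MvPolynomial.aeval (fun v => C (w v) * X v) (perPoly (Fin n) ℝ)) =
      t ^ (if π c₁ = ρ c₁ then 1 else 0) * t⁻¹ ^ (if π c₂ = ρ c₂ then 1 else 0) := by
  rw [coeff_scale, coeff_permMonomial_perPoly, mul_one, prod_wt_pow_permMonomial ρ π c₁ c₂ t hw]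

/-- Non-association: for `t, t' ≠ 0`, `per_t ~ per_{t'}` forces `t = t'` (compare the coefficients
at `μ_ρ` and at `μ_{ρ ∘ (c₂ c₃)}`; three distinct columns are needed). [folklore] -/
theorem eq_of_associated_scale_perPoly (ρ : Equiv.Perm (Fin n)) {c₁ c₂ c₃ : Fin n}
    (h₁₂ : c₁ ≠ c₂) (h₁₃ : c₁ ≠ c₃) (h₂₃ : c₂ ≠ c₃) {t t' : ℝ} (ht : t ≠ 0) (ht' : t' ≠ 0)
    {w w' : Fin n × Fin n → ℝ} (hw : w = Pi.mulSingle (ρ c₁, c₁) t * Pi.mulSingle (ρ c₂, c₂) t⁻¹)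
    (hw' : w' = Pi.mulSingle (ρ c₁, c₁) t' * Pi.mulSingle (ρ c₂, c₂) t'⁻¹)
    (h : Associated (MvPolynomial.aeval (fun v => C (w v) * X v) (perPoly (Fin n) ℝ))
      (MvPolynomial.aeval (fun v => C (w' v) * X v) (perPoly (Fin n) ℝ))) : t = t' := by
  obtain ⟨u, hu⟩ := h
  obtain ⟨c, -, hc⟩ := MvPolynomial.isUnit_iff_eq_C_of_isReduced.mp u.isUnit
  rw [hc, mul_comm _ (C c)] at hu
  -- coefficient at `μ_ρ`: `c = 1`
  have hρ := congrArg (coeff (permMonomial ρ)) hu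
  rw [coeff_C_mul, coeff_permMonomial_scale_perPoly ρ ρ c₁ c₂ t hw,
    coeff_permMonomial_scale_perPoly ρ ρ c₁ c₂ t' hw', if_pos rfl, if_pos rfl] at hρ
  simp only [pow_one, mul_inv_cancel₀ ht, mul_inv_cancel₀ ht', mul_one] at hρ
  -- coefficient at `μ_τ`, `τ = ρ ∘ (c₂ c₃)` (through `(ρ c₁, c₁)`, not through `(ρ c₂, c₂)`)
  have hτ₁ : (ρ * Equiv.swap c₂ c₃) c₁ = ρ c₁ := by
    rw [Equiv.Perm.mul_apply, Equiv.swap_apply_of_ne_of_ne h₁₂ h₁₃]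
  have hτ₂ : ¬ (ρ * Equiv.swap c₂ c₃) c₂ = ρ c₂ := by
    rw [Equiv.Perm.mul_apply, Equiv.swap_apply_left, ρ.injective.eq_iff]
    exact fun h => h₂₃ h.symm
  have hτ := congrArg (coeff (permMonomial (ρ * Equiv.swap c₂ c₃))) hu
  rw [coeff_C_mul, coeff_permMonomial_scale_perPoly ρ _ c₁ c₂ t hw,
    coeff_permMonomial_scale_perPoly ρ _ c₁ c₂ t' hw', if_pos hτ₁, if_neg hτ₂] at hτ
  simpa only [pow_one, pow_zero, mul_one, hρ, one_mul] using hτ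

/-- Core of the torus argument: a polynomial that is fixed by the one-parameter torus
`W t = (x_{(ρ c₁, c₁)} ↦ t x_{(ρ c₁, c₁)}, x_{(ρ c₂, c₂)} ↦ t⁻¹ x_{(ρ c₂, c₂)})` (a third column
`c₃` being available) and divisible by `per_n` vanishes — otherwise `per_1, per_2, per_3, …`
would be infinitely many pairwise non-associated irreducible divisors of it. [folklore] -/
theorem eq_zero_of_fixed_of_perPoly_dvd (ρ : Equiv.Perm (Fin n)) {c₁ c₂ c₃ : Fin n}
    (h₁₂ : c₁ ≠ c₂) (h₁₃ : c₁ ≠ c₃) (h₂₃ : c₂ ≠ c₃) (W : ℝ → Fin n × Fin n → ℝ)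
    (hW : ∀ t, W t = Pi.mulSingle (ρ c₁, c₁) t * Pi.mulSingle (ρ c₂, c₂) t⁻¹)
    {F : MvPolynomial (Fin n × Fin n) ℝ}
    (hfix : ∀ t : ℝ, t ≠ 0 → MvPolynomial.aeval (fun v => C (W t v) * X v) F = F)
    (hdvd : perPoly (Fin n) ℝ ∣ F) : F = 0 := by
  classical
  by_contra hF0
  haveI : Nonempty (Fin n) := ⟨c₁⟩
  have hirr : ∀ t : ℝ, t ≠ 0 →
      Irreducible (MvPolynomial.aeval (fun v => C (W t v) * X v) (perPoly (Fin n) ℝ)) :=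
    fun t ht => irreducible_scale (w' := W t⁻¹)
      (fun v => by rw [hW t, hW t⁻¹]; exact wt_mul_wt_inv _ _ ht v) perPoly_irreducible
  have hdvdT : ∀ t : ℝ, t ≠ 0 →
      MvPolynomial.aeval (fun v => C (W t v) * X v) (perPoly (Fin n) ℝ) ∣ F := fun t ht => by
    have := map_dvd (MvPolynomial.aeval fun v => C (W t v) * X v) hdvd
    rwa [hfix t ht] at this
  -- every `per_{k+1}`, `k ∈ ℕ`, is associated to a member of the finite multiset `factors F`
  have key : ∀ k : ℕ, ∃ q ∈ UniqueFactorizationMonoid.factors F, Associated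
      (MvPolynomial.aeval (fun v => C (W ((k : ℝ) + 1) v) * X v) (perPoly (Fin n) ℝ)) q :=
    fun k => UniqueFactorizationMonoid.exists_mem_factors_of_dvd hF0
      (hirr _ (Nat.cast_add_one_ne_zero k)) (hdvdT _ (Nat.cast_add_one_ne_zero k))
  choose q hq hassoc using key
  obtain ⟨k, k', hne, heq⟩ := Finite.exists_ne_map_eq_of_infinite
    (fun k => (⟨q k, Multiset.mem_toFinset.mpr (hq k)⟩ :
      {x // x ∈ (UniqueFactorizationMonoid.factors F).toFinset}))
  have hqq : q k = q k' := congrArg Subtype.val heq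
  have hkk : (k : ℝ) + 1 = (k' : ℝ) + 1 :=
    eq_of_associated_scale_perPoly ρ h₁₂ h₁₃ h₂₃ (Nat.cast_add_one_ne_zero k)
      (Nat.cast_add_one_ne_zero k') (hW _) (hW _)
      ((hassoc k).trans (by rw [hqq]; exact (hassoc k').symm))
  exact hne (by exact_mod_cast add_right_cancel hkk)

/-- **stub_disjointClassSterile — A CELL-DISJOINT CLASS OF PERMUTATION MONOMIALS IS STERILE.**
Let `n ≥ 3` and let `σ_i` be permutations with pairwise DISJOINT cell sets
(`σ_i(c) = σ_j(c) ⇒ i = j`; e.g. the three even permutations of `S₃`, the rows of a Latin square).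
If a real polynomial `R` in the monomials `x^{μ_{σ_i}}` is a multiple of `per_n`, it is `0`.
Proof: torus scaling `x_{e₁} ↦ t x_{e₁}`, `x_{e₂} ↦ t⁻¹ x_{e₂}` through two cells of one `σ_{i₀}`
fixes every generator (disjointness), hence `R(x^μ)`, and moves `per_n` to infinitely many pairwise
non-associated irreducible divisors `per_t` of `R(x^μ)` (`eq_zero_of_fixed_of_perPoly_dvd`).
[folklore] -/
theorem stub_disjointClassSterile (n : ℕ) (hn : 3 ≤ n) {ι : Type} [Fintype ι] [DecidableEq ι]
    (σ : ι → Equiv.Perm (Fin n)) (hdisj : ∀ i j (c : Fin n), σ i c = σ j c → i = j)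
    (R : MvPolynomial ι ℝ)
    (hdvd : perPoly (Fin n) ℝ ∣
      MvPolynomial.aeval (fun i => (monomial (permMonomial (σ i)) (1 : ℝ) :
        MvPolynomial (Fin n × Fin n) ℝ)) R) :
    MvPolynomial.aeval (fun i => (monomial (permMonomial (σ i)) (1 : ℝ) :
        MvPolynomial (Fin n × Fin n) ℝ)) R = 0 := by
  -- three distinct columns (`n ≥ 3`)
  obtain ⟨c₁, c₂, c₃, h₁₂, h₁₃, h₂₃⟩ : ∃ c₁ c₂ c₃ : Fin n, c₁ ≠ c₂ ∧ c₁ ≠ c₃ ∧ c₂ ≠ c₃ :=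
    ⟨⟨0, by omega⟩, ⟨1, by omega⟩, ⟨2, by omega⟩, by simp, by simp, by simp⟩
  -- a permutation `ρ` meeting each `σ_i` at column `c₁` iff at column `c₂`
  obtain ⟨ρ, hρ⟩ : ∃ ρ : Equiv.Perm (Fin n), ∀ i, σ i c₁ = ρ c₁ ↔ σ i c₂ = ρ c₂ := by
    rcases isEmpty_or_nonempty ι with hι | ⟨⟨i₀⟩⟩
    · exact ⟨1, fun i => isEmptyElim i⟩
    · exact ⟨σ i₀, fun i =>
        ⟨fun h => by rw [hdisj i i₀ c₁ h], fun h => by rw [hdisj i i₀ c₂ h]⟩⟩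
  refine eq_zero_of_fixed_of_perPoly_dvd ρ h₁₂ h₁₃ h₂₃
    (fun t => Pi.mulSingle (ρ c₁, c₁) t * Pi.mulSingle (ρ c₂, c₂) t⁻¹) (fun t => rfl)
    (fun t ht => ?_) hdvd
  -- the torus fixes every generator, hence `R(x^μ)`
  rw [comp_aeval_apply]
  refine congrArg (fun g => MvPolynomial.aeval g R) (funext fun i => ?_)
  rw [scale_monomial, prod_wt_pow_permMonomial ρ (σ i) c₁ c₂ t rfl, mul_one]
  by_cases hi : σ i c₁ = ρ c₁
  · rw [if_pos hi, if_pos ((hρ i).mp hi), pow_one, pow_one, mul_inv_cancel₀ ht]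
  · rw [if_neg hi, if_neg fun h => hi ((hρ i).mpr h), pow_zero, pow_zero, mul_one]

end Main

end Summit.ValiantsHypothesis.ValiantsHypothesis.Theorems.DivisionGap.PerCofactorDegreeReduction.DisjointClassSterile

end
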